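import Literature.NumberTheory.EllipticCurves.DeligneSerreWeightOneProofs
import Literature.NumberTheory.EllipticCurves.DeligneSerreProp27Proofs
import Literature.NumberTheory.EllipticCurves.DeligneSerreProp27LevelDescentProofs
import Literature.NumberTheory.GaloisRepresentations.IntegralGaloisActionProofs
import Mathlib.NumberTheory.Padics.Complex
import Mathlib.FieldTheory.Finite.Extension
import Mathlib.RingTheory.Valuation.Integral
import HarnessLib

/-!
# Stub `stub_residueAdaptedEmbedding` of line adelic-newform-datum-double-twist (crux stmt-Langlands-12944 `PhantomRMYoshida.SerreKWAutomorphicGL2`)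

For a newform `f ∈ S_w(Γ₁(N))` with coefficient field `K_f = coeffCharField f ⊆ ℂ` (a number
field) and ring of integers `𝓞_f = coeffCharIntegers f`, a prime `p`, an algebraically closed
field `k` of characteristic `p`, a ring map `red : 𝒪_{ℚ̄_p} → k`, a field isomorphism
`ι : ℚ̄_p ≃ ℂ` and ANY ring map `j : 𝓞_f → k`, we produce an embedding `τ : K_f → ℂ` and a ring
map `θ : 𝓞_f → 𝒪_{ℚ̄_p}` with `θ = ι⁻¹ ∘ τ` on `𝓞_f` and `red ∘ θ = j`.

Proof.  (1) `K_f` is a number field (Deligne–Serre 1974, (2.7.2)–(2.7.3), proved in the tree);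
embed `ℚ̄ ↪ ℚ̄_p` (`φ₀`), `K_f ↪ ℚ̄` (`e₀`), and restrict to `ψ₀ : ℤ̄ → 𝒪 = 𝒪_{ℚ̄_p}`,
`fA : 𝓞_f → ℤ̄`.  (2) The prime `ker (red ∘ ψ₀)` of `ℤ̄` and a prime of `ℤ̄` above `ker j` both
lie over `(p)`, so they are conjugate under `Gal(ℚ̄/ℚ)` (transitivity, Neukirch I (9.1); the
tree's `exists_smul_eq_of_mem_primesAbove_holds`); after twisting by that `σ`,
`red ∘ ψ₀ ∘ σ ∘ fA` and `j` are two ring maps `𝓞_f → k` with the same kernel `𝔮 ∋ p`.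
(3) Two ring maps with the same kernel and finite residue ring `𝓞_f / 𝔮` differ by a power of
Frobenius (Galois theory of finite fields: `exists_apply_eq_pow_of_ker_eq`).  (4) A power of an
arithmetic Frobenius of `Gal(ℚ̄/ℚ)` at `ker (red ∘ ψ₀)` (the tree's
`exists_isArithFrobAt_of_mem_primesAbove_holds`, Neukirch I (9.4)) realises that power inside
`ℚ̄`; `g = Frob^n σ`, `τ = ι ∘ φ₀ ∘ g ∘ e₀`, `θ = ψ₀ ∘ g ∘ fA`.  (5) `p`-integrality of
`ι⁻¹ ∘ τ = φ₀ ∘ g ∘ e₀` on `𝓞_f` is integrality of algebraic integers in the valuation ring `𝒪`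
(`mem_valuedInteger_of_isIntegral`).  No property of `red` beyond being a ring map into
characteristic `p` is used.

References: J. Neukirch, *Algebraic Number Theory* (1999), Ch. I §9 (9.1), (9.4), Ch. II (8.1)–(8.2);
J.-P. Serre, *Local Fields*, Ch. I §7; F. Diamond, J. Shurman, *A First Course in Modular Forms*,
§6.5 (coefficient fields of newforms).
-/

noncomputable section

open scoped NNReal NumberField Pointwise
open NumberField IsDedekindDomain CongruenceSubgroup Literature.NumberTheory.Automorphic
  Literature.NumberTheory.EllipticCurves.ModularForms Literature.NumberTheory.GaloisRepresentations

namespace Summit.Langlands.Langlands.Cruxes.SerreKWAutomorphicGL2.AdelicNewformDatumDoubleTwist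

set_option linter.dupNamespace false

/-! ## (5) Algebraic integers of `ℚ̄_p` are `p`-integral -/

section Integrality

variable {p : ℕ} [Fact p.Prime]

/-- Elements of `ℚ̄_p` integral over `ℤ` lie in the valuation ring `𝒪_{ℚ̄_p}` (valuation rings
are integrally closed, Mathlib `Valuation.Integers.mem_of_integral`). [folklore] -/
theorem mem_valuedInteger_of_isIntegral {x : PadicAlgCl p} (hx : IsIntegral ℤ x) :
    x ∈ Valued.integer (PadicAlgCl p) := by
  have hx' : IsIntegral (Valued.v : Valuation (PadicAlgCl p) ℝ≥0).integer x := hx.tower_top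
  exact Valuation.Integers.mem_of_integral (Valuation.integer.integers
    (Valued.v : Valuation (PadicAlgCl p) ℝ≥0)) hx'

end Integrality

/-! ## (3) Two embeddings of a finite residue field differ by a power of Frobenius -/

section FrobeniusTwist

/-- **Ring maps with the same kernel and finite image differ by a power of Frobenius.**  Let
`e₁, e₂ : A → k` be ring maps to a field of characteristic `p` with `ker e₁ = ker e₂ = 𝔮` and
`A / 𝔮` finite.  Then `e₂ = Frob^n ∘ e₁` for some `n`: both maps factor through embeddings of the
finite field `F = A / 𝔮`, which differ by an automorphism of `F` (normality of `F / 𝔽_p`), and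
`Aut(F / 𝔽_p)` is generated by Frobenius (Mathlib `FiniteField.exists_forall_apply_eq_pow`).
[folklore] -/
theorem exists_apply_eq_pow_of_ker_eq {A : Type*} [CommRing A] {k : Type*} [Field k] {p : ℕ}
    [Fact p.Prime] [CharP k p] (e₁ e₂ : A →+* k) (hker : RingHom.ker e₁ = RingHom.ker e₂)
    [Finite (A ⧸ RingHom.ker e₁)] : ∃ n : ℕ, ∀ x, e₂ x = e₁ x ^ p ^ n := by
  classical
  haveI : NeZero p := ⟨(Fact.out : p.Prime).ne_zero⟩
  haveI hprime : (RingHom.ker e₁).IsPrime := RingHom.ker_isPrime e₁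
  haveI hmax : (RingHom.ker e₁).IsMaximal :=
    Ideal.Quotient.maximal_of_isField _ (Finite.isField_of_domain (A ⧸ RingHom.ker e₁))
  letI : Field (A ⧸ RingHom.ker e₁) := Ideal.Quotient.field (RingHom.ker e₁)
  let q₁ : (A ⧸ RingHom.ker e₁) →+* k :=
    Ideal.Quotient.lift (RingHom.ker e₁) e₁ fun a ha ↦ RingHom.mem_ker.mp ha
  let q₂ : (A ⧸ RingHom.ker e₁) →+* k :=
    Ideal.Quotient.lift (RingHom.ker e₁) e₂ fun a ha ↦ by
      rw [hker] at ha
      exact RingHom.mem_ker.mp ha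
  have hq₁ : ∀ a, q₁ (Ideal.Quotient.mk _ a) = e₁ a := fun a ↦ Ideal.Quotient.lift_mk _ _ _
  have hq₂ : ∀ a, q₂ (Ideal.Quotient.mk _ a) = e₂ a := fun a ↦ Ideal.Quotient.lift_mk _ _ _
  haveI : CharP (A ⧸ RingHom.ker e₁) p := q₁.charP q₁.injective p
  letI : Algebra (ZMod p) (A ⧸ RingHom.ker e₁) := ZMod.algebra _ p
  letI : Algebra (ZMod p) k := ZMod.algebra _ p
  let q₁' : (A ⧸ RingHom.ker e₁) →ₐ[ZMod p] k :=
    { q₁ with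
      commutes' := fun r ↦ by
        change q₁ (algebraMap (ZMod p) _ r) = algebraMap (ZMod p) k r
        exact RingHom.congr_fun
          (Subsingleton.elim (q₁.comp (algebraMap (ZMod p) _)) (algebraMap (ZMod p) k)) r }
  let q₂' : (A ⧸ RingHom.ker e₁) →ₐ[ZMod p] k :=
    { q₂ with
      commutes' := fun r ↦ by
        change q₂ (algebraMap (ZMod p) _ r) = algebraMap (ZMod p) k r
        exact RingHom.congr_fun
          (Subsingleton.elim (q₂.comp (algebraMap (ZMod p) _)) (algebraMap (ZMod p) k)) r }
  have hq₁' : ∀ y, q₁' y = q₁ y := fun _ ↦ rfl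
  have hq₂' : ∀ y, q₂' y = q₂ y := fun _ ↦ rfl
  letI : Algebra (A ⧸ RingHom.ker e₁) k := q₁.toAlgebra
  haveI : IsScalarTower (ZMod p) (A ⧸ RingHom.ker e₁) k :=
    IsScalarTower.of_algebraMap_eq fun r ↦ (q₁'.commutes r).symm
  let g : (A ⧸ RingHom.ker e₁) ≃ₐ[ZMod p] (A ⧸ RingHom.ker e₁) :=
    q₂'.restrictNormal' (A ⧸ RingHom.ker e₁)
  have hg : ∀ y, q₁ (g y) = q₂ y := fun y ↦ by
    have h := q₂'.restrictNormal_commutes (A ⧸ RingHom.ker e₁) y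
    rw [Algebra.algebraMap_self, RingHom.id_apply, hq₂'] at h
    exact h
  obtain ⟨i, hi⟩ := FiniteField.exists_forall_apply_eq_pow (ZMod p) p (A ⧸ RingHom.ker e₁) g
  refine ⟨i, fun x ↦ ?_⟩
  have h := hg (Ideal.Quotient.mk _ x)
  rw [hi, Nat.card_zmod, map_pow, hq₁, hq₂] at h
  exact h.symm

end FrobeniusTwist

/-! ## (2), (4) Transitivity and Frobenius in `Gal(ℚ̄/ℚ)` acting on `ℤ̄` -/

section AbsoluteGalois

open Field

/-- The residue ring of `𝓞 ℚ` at a rational prime `p` has `p` elements: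
`#(𝓞 ℚ / (p)) = |N(p)| = p`. [folklore] -/
theorem natCard_ringOfIntegers_rat_quot_span_natCast (p : ℕ) [Fact p.Prime] :
    Nat.card (𝓞 ℚ ⧸ Ideal.span {((p : ℕ) : 𝓞 ℚ)}) = p := by
  rw [← Submodule.cardQuot_apply, ← Ideal.absNorm_apply, Ideal.absNorm_span_singleton]
  have : ((p : ℕ) : 𝓞 ℚ) = algebraMap ℤ (𝓞 ℚ) (p : ℤ) := by simp
  rw [this, Algebra.norm_algebraMap, RingOfIntegers.rank, Module.finrank_self, pow_one,
    Int.natAbs_natCast]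

/-- **Residue-adapted Galois twist on `ℤ̄`.**  Let `χ : ℤ̄ → k` be a ring map to a field of
characteristic `p` (`ℤ̄ = absIntegers (𝓞 ℚ) ℚ`), `K` a number field with an injective ring map
`fA : 𝓞 K → ℤ̄`, and `j : 𝓞 K → k` any ring map.  Then `χ (g • fA x) = j x` on `𝓞 K` for some
`g ∈ Gal(ℚ̄/ℚ)`.  Proof: a prime `𝔔` of `ℤ̄` above `ker j` and `ker χ` both lie over `(p)`,
hence `σ • 𝔔 = ker χ` (transitivity, Neukirch I (9.1)); `χ ∘ σ ∘ fA` and `j` then have the same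
kernel, so differ by `Frob^n` on the finite residue field (`exists_apply_eq_pow_of_ker_eq`); take
`g = φ^n σ` for an arithmetic Frobenius `φ` at `ker χ` (Neukirch I (9.4)).
[cite: NeukirchANT1999, Ch. I §9 Prop. (9.1) and Prop. (9.4)] -/
theorem exists_absoluteGaloisGroup_smul_eq {p : ℕ} [Fact p.Prime] {k : Type*} [Field k]
    [CharP k p] (χ : absIntegers (𝓞 ℚ) ℚ →+* k) {K : Type*} [Field K] [NumberField K]
    (fA : 𝓞 K →+* absIntegers (𝓞 ℚ) ℚ) (hfA : Function.Injective fA) (j : 𝓞 K →+* k) :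
    ∃ g : absoluteGaloisGroup ℚ, ∀ x : 𝓞 K, χ (g • fA x) = j x := by
  classical
  have hp : p.Prime := Fact.out
  -- `ℤ̄` is integral over `𝓞 K` along `fA`
  letI : Algebra (𝓞 K) (absIntegers (𝓞 ℚ) ℚ) := fA.toAlgebra
  have halg : ∀ r : 𝓞 K, algebraMap (𝓞 K) (absIntegers (𝓞 ℚ) ℚ) r = fA r := fun _ ↦ rfl
  haveI : Algebra.IsIntegral (𝓞 K) (absIntegers (𝓞 ℚ) ℚ) := ⟨fun x ↦ by
    have h1 : IsIntegral (𝓞 ℚ) x := integralClosure.isIntegral x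
    have h2 : IsIntegral ℤ x := isIntegral_trans (R := ℤ) _ h1
    exact h2.tower_top⟩
  -- the primes `𝔮 = ker j`, `𝔔 ∣ 𝔮` of `ℤ̄`, and `𝔓₀ = ker χ`
  set 𝔮 : Ideal (𝓞 K) := RingHom.ker j with h𝔮def
  haveI : 𝔮.IsPrime := RingHom.ker_isPrime j
  have hkerle : RingHom.ker (algebraMap (𝓞 K) (absIntegers (𝓞 ℚ) ℚ)) ≤ 𝔮 := by
    intro x hx
    rw [RingHom.mem_ker, halg] at hx
    have hx0 : x = 0 := hfA (by rw [map_zero]; exact hx)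
    rw [hx0]
    exact 𝔮.zero_mem
  obtain ⟨𝔔, h𝔔prime, h𝔔over⟩ :=
    Ideal.exists_ideal_over_prime_of_isIntegral_of_isDomain (S := absIntegers (𝓞 ℚ) ℚ) 𝔮 hkerle
  have hmem𝔔 : ∀ r : 𝓞 K, fA r ∈ 𝔔 ↔ r ∈ 𝔮 := fun r ↦ by
    rw [← h𝔔over, Ideal.mem_comap, halg]
  set 𝔓₀ : Ideal (absIntegers (𝓞 ℚ) ℚ) := RingHom.ker χ with h𝔓₀def
  haveI h𝔓₀ : 𝔓₀.IsPrime := RingHom.ker_isPrime χ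
  -- both lie over `(p) ⊂ 𝓞 ℚ`
  have hp𝔓₀ : algebraMap (𝓞 ℚ) (absIntegers (𝓞 ℚ) ℚ) p ∈ 𝔓₀ := by
    rw [h𝔓₀def, RingHom.mem_ker, map_natCast, map_natCast, CharP.cast_eq_zero]
  have hp𝔮 : ((p : ℕ) : 𝓞 K) ∈ 𝔮 := by
    rw [h𝔮def, RingHom.mem_ker, map_natCast, CharP.cast_eq_zero]
  have hp𝔔 : algebraMap (𝓞 ℚ) (absIntegers (𝓞 ℚ) ℚ) p ∈ 𝔔 := by
    have h1 : fA (p : 𝓞 K) ∈ 𝔔 := (hmem𝔔 _).mpr hp𝔮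
    rw [map_natCast] at h1
    rwa [map_natCast]
  have hspan_max : (Ideal.span {((p : ℕ) : 𝓞 ℚ)}).IsMaximal := by
    have hprime : Prime ((p : ℕ) : 𝓞 ℚ) := by
      rw [← MulEquiv.prime_iff Rat.ringOfIntegersEquiv, map_natCast]
      exact Nat.prime_iff_prime_int.mp hp
    have hne : ((p : ℕ) : 𝓞 ℚ) ≠ 0 := hprime.ne_zero
    haveI : (Ideal.span {((p : ℕ) : 𝓞 ℚ)}).IsPrime := (Ideal.span_singleton_prime hne).mpr hprime
    exact Ideal.IsPrime.isMaximal inferInstance (by rw [Ne, Ideal.span_singleton_eq_bot]; exact hne)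
  have hunder : ∀ (P : Ideal (absIntegers (𝓞 ℚ) ℚ)) [P.IsPrime],
      algebraMap (𝓞 ℚ) (absIntegers (𝓞 ℚ) ℚ) p ∈ P →
      P.under (𝓞 ℚ) = Ideal.span {((p : ℕ) : 𝓞 ℚ)} := by
    intro P _ hP
    symm
    refine hspan_max.eq_of_le (Ideal.IsPrime.under (𝓞 ℚ) P).ne_top ?_
    rw [Ideal.span_le, Set.singleton_subset_iff]
    exact hP
  have heq : 𝔓₀.under (𝓞 ℚ) = 𝔔.under (𝓞 ℚ) := by
    haveI := h𝔔prime
    rw [hunder 𝔓₀ hp𝔓₀, hunder 𝔔 hp𝔔]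
  have hwbot : 𝔓₀.under (𝓞 ℚ) ≠ ⊥ := by
    intro h
    have h1 : ((p : ℕ) : 𝓞 ℚ) ∈ 𝔓₀.under (𝓞 ℚ) := hp𝔓₀
    rw [h, Ideal.mem_bot] at h1
    exact hp.ne_zero (by exact_mod_cast h1)
  let w : HeightOneSpectrum (𝓞 ℚ) := ⟨𝔓₀.under (𝓞 ℚ), inferInstance, hwbot⟩
  have h𝔓₀w : 𝔓₀ ∈ w.primesAbove := ⟨h𝔓₀, ⟨rfl⟩⟩
  have h𝔔w : 𝔔 ∈ w.primesAbove := ⟨h𝔔prime, ⟨heq⟩⟩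
  -- transitivity: `σ • 𝔔 = 𝔓₀`
  obtain ⟨σ, hσ⟩ := HeightOneSpectrum.exists_smul_eq_of_mem_primesAbove_holds h𝔔w h𝔓₀w
  -- the twisted map `e₁ = χ ∘ σ ∘ fA` has kernel `𝔮`
  let e₁ : 𝓞 K →+* k :=
    χ.comp ((MulSemiringAction.toRingHom (absoluteGaloisGroup ℚ) (absIntegers (𝓞 ℚ) ℚ) σ).comp fA)
  have he₁ : ∀ x, e₁ x = χ (σ • fA x) := fun _ ↦ rfl
  have hker : RingHom.ker e₁ = RingHom.ker j := by
    ext x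
    rw [RingHom.mem_ker, he₁, ← RingHom.mem_ker, ← h𝔓₀def, ← hσ,
      Ideal.smul_mem_pointwise_smul_iff, hmem𝔔, h𝔮def]
  -- the residue ring `𝓞 K / 𝔮` is finite
  have h𝔮bot : 𝔮 ≠ ⊥ := by
    intro h
    have h1 := hp𝔮
    rw [h, Ideal.mem_bot] at h1
    exact hp.ne_zero (by exact_mod_cast h1)
  haveI : Finite (𝓞 K ⧸ RingHom.ker e₁) := by
    rw [hker]
    exact Ideal.finiteQuotientOfFreeOfNeBot 𝔮 h𝔮bot
  obtain ⟨n, hn⟩ := exists_apply_eq_pow_of_ker_eq e₁ j hker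
  -- an arithmetic Frobenius `φ` at `𝔓₀`: `χ (φ • y) = χ y ^ p`
  obtain ⟨φ, hφ⟩ := HeightOneSpectrum.exists_isArithFrobAt_of_mem_primesAbove_holds h𝔓₀w
  rw [HeightOneSpectrum.isArithFrobAt_iff_of_mem_primesAbove h𝔓₀w] at hφ
  have hcard : w.residueCard = p := by
    change Ideal.absNorm (𝔓₀.under (𝓞 ℚ)) = p
    rw [hunder 𝔓₀ hp𝔓₀, Ideal.absNorm_apply, Submodule.cardQuot_apply]
    exact natCard_ringOfIntegers_rat_quot_span_natCast p
  have hφ1 : ∀ y, χ (φ • y) = χ y ^ p := fun y ↦ by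
    have h := hφ y
    rw [hcard, h𝔓₀def, RingHom.mem_ker, map_sub, sub_eq_zero, map_pow] at h
    exact h
  have hφn : ∀ (m : ℕ) y, χ (φ ^ m • y) = χ y ^ p ^ m := by
    intro m
    induction m with
    | zero => intro y; simp
    | succ m ih =>
      intro y
      rw [pow_succ', mul_smul, hφ1, ih, ← pow_mul, ← pow_succ]
  refine ⟨φ ^ n * σ, fun x ↦ ?_⟩
  rw [mul_smul, hφn, ← he₁, hn x]

end AbsoluteGalois

/-! ## The stub -/

/-- **Stub `stub_residueAdaptedEmbedding` (lever (A) of the line): residue-adapted embeddings of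
the coefficient ring of a newform.**  For a newform `f ∈ S_w(Γ₁(N))`, a prime `p`, an
algebraically closed field `k` of characteristic `p`, `red : 𝒪_{ℚ̄_p} → k`, `ι : ℚ̄_p ≃ ℂ` and any
`j : 𝓞_f → k`, there are `τ : K_f → ℂ` and `θ : 𝓞_f → 𝒪_{ℚ̄_p}` with `θ = ι⁻¹ ∘ τ` on `𝓞_f` and
`red ∘ θ = j`.  Proof: `K_f` is a number field (Deligne–Serre (2.7.2)–(2.7.3), proved in the
tree); embed `K_f ↪ ℚ̄ ↪ ℚ̄_p`, twist by the `g ∈ Gal(ℚ̄/ℚ)` of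
`exists_absoluteGaloisGroup_smul_eq` applied to `χ = red ∘ (ℤ̄ → 𝒪_{ℚ̄_p})`, and put
`τ = ι ∘ φ₀ ∘ g ∘ e₀`, `θ = ψ₀ ∘ g ∘ e₀` (prime above `p` ↔ embedding into `ℚ̄_p`, Neukirch II
(8.1)–(8.2); Frobenius adjustment through the decomposition group, Neukirch I (9.4);
Diamond–Shurman §6.5 for `K_f`). [cite: NeukirchANT1999, Ch. II (8.1)–(8.2) and Ch. I §9 (9.1), (9.4)] -/
theorem stub_residueAdaptedEmbedding :
    ∀ (p : ℕ) [Fact p.Prime] (k : Type) [Field k] [CharP k p] [IsAlgClosed k]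
      (red : Valued.integer (PadicAlgCl p) →+* k) (ι : PadicAlgCl p ≃+* ℂ)
      (N : ℕ) [NeZero N] (w : ℤ) (f : CuspForm (Gamma1 N) w), IsNewform1 f →
      ∀ (j : coeffCharIntegers f →+* k),
        ∃ (τ : coeffCharField f →+* ℂ) (θ : coeffCharIntegers f →+* Valued.integer (PadicAlgCl p)),
          (∀ x : coeffCharIntegers f,
              ((θ x : Valued.integer (PadicAlgCl p)) : PadicAlgCl p) =
                ι.symm (τ (algebraMap (coeffCharIntegers f) (coeffCharField f) x))) ∧
          ∀ x : coeffCharIntegers f, red (θ x) = j x := by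
  intro p _ k _ _ _ red ι N _ w f hf j
  classical
  -- `K_f` is a number field
  haveI : FiniteDimensional ℚ (coeffField f) :=
    (IsNewform1.finiteDimensional_coeffField_of_span_integralLattice1
      (DeligneSerre1974_span_integralLattice1_holds N w)) hf
  haveI : FiniteDimensional ℚ (coeffCharField f) :=
    DeligneSerre1974.finiteDimensional_coeffCharField f
  set K₀ : IntermediateField ℚ ℂ := coeffCharField f with hK₀
  haveI : NumberField K₀ := NumberField.mk
  let j₀ : 𝓞 K₀ →+* k := j
  -- `ℚ̄ ↪ ℚ̄_p` and `K_f ↪ ℚ̄`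
  haveI : Algebra.IsAlgebraic ℚ (AlgebraicClosure ℚ) := by
    convert AlgebraicClosure.isAlgebraic ℚ
    all_goals rfl
  let φ₀ : AlgebraicClosure ℚ →ₐ[ℚ] PadicAlgCl p := IsAlgClosed.lift
  let e₀ : K₀ →ₐ[ℚ] AlgebraicClosure ℚ := IsAlgClosed.lift
  -- `ψ₀ : ℤ̄ → 𝒪_{ℚ̄_p}`
  have hφint : ∀ x : absIntegers (𝓞 ℚ) ℚ,
      φ₀ (x : AlgebraicClosure ℚ) ∈ Valued.integer (PadicAlgCl p) := by
    intro x
    apply mem_valuedInteger_of_isIntegral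
    have h1 : IsIntegral (𝓞 ℚ) (x : AlgebraicClosure ℚ) := x.2
    have h2 : IsIntegral ℤ (x : AlgebraicClosure ℚ) := isIntegral_trans (R := ℤ) _ h1
    exact h2.map φ₀.toRingHom.toIntAlgHom
  let ψ₀ : absIntegers (𝓞 ℚ) ℚ →+* Valued.integer (PadicAlgCl p) :=
    { toFun := fun x ↦ ⟨φ₀ (x : AlgebraicClosure ℚ), hφint x⟩
      map_one' := Subtype.ext (by simp)
      map_mul' := fun x y ↦ Subtype.ext (by simp)
      map_zero' := Subtype.ext (by simp)
      map_add' := fun x y ↦ Subtype.ext (by simp) }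
  have hψ₀ : ∀ x : absIntegers (𝓞 ℚ) ℚ,
      ((ψ₀ x : Valued.integer (PadicAlgCl p)) : PadicAlgCl p) = φ₀ (x : AlgebraicClosure ℚ) :=
    fun _ ↦ rfl
  -- `fA : 𝓞 K_f → ℤ̄` along `e₀`
  have heint : ∀ r : 𝓞 K₀, IsIntegral (𝓞 ℚ) (e₀ (r : K₀)) := by
    intro r
    have h1 : IsIntegral ℤ (e₀ (r : K₀)) :=
      (r.2 : IsIntegral ℤ (r : K₀)).map e₀.toRingHom.toIntAlgHom
    exact h1.tower_top
  let fA : 𝓞 K₀ →+* absIntegers (𝓞 ℚ) ℚ :=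
    { toFun := fun r ↦ ⟨e₀ (r : K₀), heint r⟩
      map_one' := Subtype.ext (by simp)
      map_mul' := fun x y ↦ Subtype.ext (by simp)
      map_zero' := Subtype.ext (by simp)
      map_add' := fun x y ↦ Subtype.ext (by simp) }
  have hfA : ∀ r : 𝓞 K₀, ((fA r : absIntegers (𝓞 ℚ) ℚ) : AlgebraicClosure ℚ) = e₀ (r : K₀) :=
    fun _ ↦ rfl
  have hfAinj : Function.Injective fA := by
    intro x y h
    have := congrArg (fun z : absIntegers (𝓞 ℚ) ℚ ↦ (z : AlgebraicClosure ℚ)) h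
    rw [hfA, hfA] at this
    exact RingOfIntegers.ext (e₀.toRingHom.injective this)
  -- the Galois twist
  obtain ⟨g, hg⟩ := exists_absoluteGaloisGroup_smul_eq (red.comp ψ₀) fA hfAinj j₀
  let gA : absIntegers (𝓞 ℚ) ℚ →+* absIntegers (𝓞 ℚ) ℚ :=
    MulSemiringAction.toRingHom (Field.absoluteGaloisGroup ℚ) (absIntegers (𝓞 ℚ) ℚ) g
  let gQ : AlgebraicClosure ℚ →+* AlgebraicClosure ℚ :=
    MulSemiringAction.toRingHom (Field.absoluteGaloisGroup ℚ) (AlgebraicClosure ℚ) g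
  let θ : 𝓞 K₀ →+* Valued.integer (PadicAlgCl p) := ψ₀.comp (gA.comp fA)
  let τ : K₀ →+* ℂ := ι.toRingHom.comp (φ₀.toRingHom.comp (gQ.comp e₀.toRingHom))
  have hθ : ∀ x : 𝓞 K₀, ((θ x : Valued.integer (PadicAlgCl p)) : PadicAlgCl p) =
      φ₀ (g • e₀ (x : K₀)) := fun x ↦ by
    change φ₀ (((g • fA x : absIntegers (𝓞 ℚ) ℚ)) : AlgebraicClosure ℚ) = _
    rw [integralClosure.coe_smul, hfA]
  have hτ : ∀ x : 𝓞 K₀, τ (x : K₀) = ι (φ₀ (g • e₀ (x : K₀))) := fun _ ↦ rfl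
  have key : ∀ x : 𝓞 K₀,
      ((θ x : Valued.integer (PadicAlgCl p)) : PadicAlgCl p) = ι.symm (τ (x : K₀)) ∧
        red (θ x) = j₀ x := fun x ↦ by
    refine ⟨?_, hg x⟩
    rw [hθ, hτ, RingEquiv.symm_apply_apply]
  exact ⟨τ, θ, fun x ↦ (key x).1, fun x ↦ (key x).2⟩

end Summit.Langlands.Langlands.Cruxes.SerreKWAutomorphicGL2.AdelicNewformDatumDoubleTwist
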